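import Literature.NumberTheory.Rogawski1990.LocalTransferTorusSingularJunctionInvCM   -- ★ p841663 F0P2-p02 (g8): the S2-Inv junction whose binder `hR1` this file pays (grammar `τ θ b₀`)
import Literature.NumberTheory.Rogawski1990.LocalCentralizerTorusMeasureCM              -- ★ `isRegularElt_fst_snd_of_isLocalGRegular`
import Literature.NumberTheory.Rogawski1990.UnitFundamentalLemmaInertLeviClause         -- ★ `isLocalGRegular_conj_iff`
import HarnessLib

/-!
# THE TORUS UNSTABLE JUNCTION — the weighted good-side sum of `R_φ` at the torus base is LOCALLY CONSTANT, over the rank-one unstable-transfer letter (R1-lc) BY NAME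
# (Rogawski 1990 Prop. 8.2.1 (c): «we reduce to a problem on SL₂ dealt with in [LL]» = Lemma 4.9.3; Labesse–Langlands 1979 §2)

Topic `NumberTheory/Rogawski1990`; namespace `Literature.NumberTheory.Rogawski1990`.  THEOREMS ONLY (no definition, no instance, no notation, no named fact, no `sorry`).
Cell `pub/hodgecm-mathlib` (D-0151), crux H413 = stmt-HodgeConjecture-24833, floor-2 line «N6nsGerm», stub `stub_N6nsS2`; LEAD F0P3a-plan (g9) WORD T8-102 (iii) ∕ T8-117 «(R1-lc)
JUNCTION → B-p08 (g27)»; census `B-provers/B-p08/g27/CENSUS-R1lc-Junction.B-p08g27.md`.  HONEST LABEL: HC_CM is proved only modulo the printed citations until rung 0 closes; this file pays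
F0P2-p02's binder `hR1` of ★ `exists_nhds_stableOrbitalIntegralRel_eq_of_torus_singular_inv` ONLY MODULO the named fact ★ `RankOneUnstableTransferNonsplit` (R1-lc) and two binders: (J2a) the
κ-ALTERNATION of `Δ‴_v(↑t, θ ·)` on the two classes of the stable class of `τ t` near the torus base, and (J2b) the EXPLICIT-FACTOR SPLIT `Δ‴_v(↑t, θ(out ⟦τ t⟧)) = E(t) · Δ_{H∕C}(τ t)`,
`E` locally constant.

THE MATHEMATICS.  For `t` near `b₀` and `G`-regular the stable class of `τ t` in `H_v` is `{⟦τ t⟧, d̄}` with `Δ‴_v(↑t, θ(out d̄)) = −Δ‴_v(↑t, θ(out ⟦τ t⟧))` (J2a), so the weighted sum is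
`c(t)·(Φ(⟦τ t⟧) − Φ(d̄)) = c(t)·(2Φ(⟦τ t⟧) − Σᶠ_{st} Φ)`, `c(t) = E(t)·Δ_{H∕C}(τ t)` with `Δ_{H∕C} = μ_w(γ₁ − γ₃)⁻¹‖γ₁ − γ₃‖` read in an eigenframe `P` of the torus `C = Z_H(t₀) ∋ τ t` (J1, J2b);
(R1-lc) at `Reg := IsLocalGRegular L v` turns `Δ_{H∕C}·Φ^κ` into a locally constant `f^C` on `C`, and `g(t) := E(t)·f^C(τ t)` is locally constant (`τ` continuous).

* `exists_nhds_finsum_delta_dock_eq_locallyConstant_of_torusTransfer` — conclusion = `hR1` verbatim; the rank-one transfer enters as the weight-agnostic binder `hLL` (the dress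
  instantiates it with ★ `RankOneUnstableTransferNonsplit`; ED. 2: the ED. 1 head `…_of_rankOneUnstable`, which quoted the letter's `D_H` factor token-exact, is superseded so that the
  junction does not pin the normalisation of `D_H` — see the bus 2026-09-01 07:03Z and ★ p842088).

References: [Rogawski1990] §8.2 Prop. 8.2.1 (c) pp. 113–115, §4.9 Lemma 4.9.3 (4.9.2) p. 56, §4.3 (4.3.1) p. 43; [LabesseLanglands1979] §2; [LanglandsShelstad1990Descent] §2.4.
-/

set_option autoImplicit false

noncomputable section

open Set Filter Topology MeasureTheory Measure
open scoped Matrix MatrixGroups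

namespace Literature.NumberTheory.Rogawski1990

open Literature.NumberTheory.Automorphic Literature.NumberTheory.Automorphic.UnitaryGroup Literature.NumberTheory.GaloisRepresentations
open _root_.NumberField _root_.IsDedekindDomain

section TorusUnstable

variable (L : Type) [Field L] [NumberField L] [IsCMField L] (H' : Matrix (Fin 3) (Fin 3) L) (v : HeightOneSpectrum (𝓞 ↥(maximalRealSubfield L)))

variable [iH : ∀ a : (((cmDatum L 2 (Matrix.of fun i j : Fin 2 => if i.val + j.val + 1 = 2 then (1 : L) else 0)).Local v) ×
      ((cmDatum L 1 (Matrix.of fun i j : Fin 1 => if i.val + j.val + 1 = 1 then (1 : L) else 0)).Local v)), MeasurableSpace ((((cmDatum L 2 (Matrix.of fun i j : Fin 2 => if i.val + j.val + 1 = 2 then (1 : L) else 0)).Local v) ×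
      ((cmDatum L 1 (Matrix.of fun i j : Fin 1 => if i.val + j.val + 1 = 1 then (1 : L) else 0)).Local v)) ⧸ Subgroup.centralizer ({a} : Set (((cmDatum L 2 (Matrix.of fun i j : Fin 2 => if i.val + j.val + 1 = 2 then (1 : L) else 0)).Local v) ×
      ((cmDatum L 1 (Matrix.of fun i j : Fin 1 => if i.val + j.val + 1 = 1 then (1 : L) else 0)).Local v))))]

/-- Sum over a two-element set written as `{d | p d}`. [folklore] -/
private theorem finsum_mem_eq_add_of_eq_pair {ι : Type*} {S : Set ι} {a b : ι} (hab : a ≠ b) (hS : S = {a, b}) (F : ι → ℂ) :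
    (∑ᶠ i ∈ S, F i) = F a + F b := by
  rw [hS]
  exact finsum_mem_pair hab

/-- **THE TORUS UNSTABLE JUNCTION (factor-agnostic form)** — F0P2-p02's binder `hR1` of ★ `exists_nhds_stableOrbitalIntegralRel_eq_of_torus_singular_inv`, PAID modulo: a torus
`C = Z_H(t₀) ∋ τ t` (J1, `hτC`); a RANK-ONE UNSTABLE TRANSFER on `C` for an arbitrary weight `fac : H_v → ℂ` (`hLL`: for every `ψε ∈ C_c^∞(H_v)` a locally constant `f^C` on `C` with
`fac(t′)·(2Φ(⟦t′⟧, ψε) − Σᶠ_{st} Φ) = f^C(t′)` at the `G`-regular `t′ ∈ C` — the dress instantiates it with the named fact ★ `RankOneUnstableTransferNonsplit` (R1-lc), `fac := Δ_{H∕C} =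
μ_w(γ₁ − γ₃)⁻¹ · D_H` in the eigenframe of `t₀`, `Reg := IsLocalGRegular L v`; stated weight-agnostically so that the junction does not depend on the normalisation of `D_H` in the letter's
text); the κ-ALTERNATION at the torus base (J2a) `halt`; and the EXPLICIT-FACTOR SPLIT (J2b) `hfac : Δ‴_v(↑t, θ(out ⟦τ t⟧)) = E(t)·fac(τ t)`, `E` locally constant.  For every
`ψε ∈ C_c^∞(H_v)`: `∃ V ∈ 𝓝 b₀, ∃ g` locally constant on `Z_H(ε_H)` with `Σᶠ_{d ∼_st τ t} Δ‴_v(↑t, θ(out d))·Φ(d, ψε; m_H) = g t` for all `G`-regular `t ∈ V`.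
[cite: Rogawski1990, §8.2 Prop. 8.2.1 (c) pp. 113–115; §4.9 Lemma 4.9.3 (4.9.2) p. 56; §4.3 (4.3.1) p. 43] [cite: LabesseLanglands1979, §2] -/
theorem exists_nhds_finsum_delta_dock_eq_locallyConstant_of_torusTransfer
    (μ : HeckeCharacter L)
    (hl : ∀ (v : HeightOneSpectrum (𝓞 ↥(maximalRealSubfield L))) (a : (((cmDatum L 2 (Matrix.of fun i j : Fin 2 => if i.val + j.val + 1 = 2 then (1 : L) else 0)).Local v) ×
      ((cmDatum L 1 (Matrix.of fun i j : Fin 1 => if i.val + j.val + 1 = 1 then (1 : L) else 0)).Local v))) (b : ((cmDatum L 3 H').Local v)) (x : (((cmDatum L 2 (Matrix.of fun i j : Fin 2 => if i.val + j.val + 1 = 2 then (1 : L) else 0)).Local v) ×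
      ((cmDatum L 1 (Matrix.of fun i j : Fin 1 => if i.val + j.val + 1 = 1 then (1 : L) else 0)).Local v))),
      finExplicitDelta L v H' (x * a * x⁻¹) μ b = finExplicitDelta L v H' a μ b)
    (hr : ∀ (v : HeightOneSpectrum (𝓞 ↥(maximalRealSubfield L))) (a : (((cmDatum L 2 (Matrix.of fun i j : Fin 2 => if i.val + j.val + 1 = 2 then (1 : L) else 0)).Local v) ×
      ((cmDatum L 1 (Matrix.of fun i j : Fin 1 => if i.val + j.val + 1 = 1 then (1 : L) else 0)).Local v))) (b y : ((cmDatum L 3 H').Local v)),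
      finExplicitDelta L v H' a μ (y * b * y⁻¹) = finExplicitDelta L v H' a μ b)
    (mH : OrbitalMeasureFamily (((cmDatum L 2 (Matrix.of fun i j : Fin 2 => if i.val + j.val + 1 = 2 then (1 : L) else 0)).Local v) ×
      ((cmDatum L 1 (Matrix.of fun i j : Fin 1 => if i.val + j.val + 1 = 1 then (1 : L) else 0)).Local v)))
    (εH : (((cmDatum L 2 (Matrix.of fun i j : Fin 2 => if i.val + j.val + 1 = 2 then (1 : L) else 0)).Local v) ×
      ((cmDatum L 1 (Matrix.of fun i j : Fin 1 => if i.val + j.val + 1 = 1 then (1 : L) else 0)).Local v))) (b₀ : ↥(Subgroup.centralizer ({εH} : Set (((cmDatum L 2 (Matrix.of fun i j : Fin 2 => if i.val + j.val + 1 = 2 then (1 : L) else 0)).Local v) ×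
      ((cmDatum L 1 (Matrix.of fun i j : Fin 1 => if i.val + j.val + 1 = 1 then (1 : L) else 0)).Local v))))) {ε : ((cmDatum L 3 H').Local v)} (θ : (((cmDatum L 2 (Matrix.of fun i j : Fin 2 => if i.val + j.val + 1 = 2 then (1 : L) else 0)).Local v) ×
      ((cmDatum L 1 (Matrix.of fun i j : Fin 1 => if i.val + j.val + 1 = 1 then (1 : L) else 0)).Local v)) ≃ₜ* ↥(Subgroup.centralizer ({ε} : Set ((cmDatum L 3 H').Local v))))
    (τ : ↥(Subgroup.centralizer ({εH} : Set (((cmDatum L 2 (Matrix.of fun i j : Fin 2 => if i.val + j.val + 1 = 2 then (1 : L) else 0)).Local v) ×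
      ((cmDatum L 1 (Matrix.of fun i j : Fin 1 => if i.val + j.val + 1 = 1 then (1 : L) else 0)).Local v)))) → (((cmDatum L 2 (Matrix.of fun i j : Fin 2 => if i.val + j.val + 1 = 2 then (1 : L) else 0)).Local v) ×
      ((cmDatum L 1 (Matrix.of fun i j : Fin 1 => if i.val + j.val + 1 = 1 then (1 : L) else 0)).Local v))) (hτc : Continuous τ)
    (hτreg : ∀ t : ↥(Subgroup.centralizer ({εH} : Set (((cmDatum L 2 (Matrix.of fun i j : Fin 2 => if i.val + j.val + 1 = 2 then (1 : L) else 0)).Local v) ×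
      ((cmDatum L 1 (Matrix.of fun i j : Fin 1 => if i.val + j.val + 1 = 1 then (1 : L) else 0)).Local v)))), IsLocalGRegular L v (t : (((cmDatum L 2 (Matrix.of fun i j : Fin 2 => if i.val + j.val + 1 = 2 then (1 : L) else 0)).Local v) ×
      ((cmDatum L 1 (Matrix.of fun i j : Fin 1 => if i.val + j.val + 1 = 1 then (1 : L) else 0)).Local v))) → IsLocalGRegular L v (τ t))
    -- (J1) the torus `C = Z_H(t₀) ∋ τ t`
    (t₀ : (((cmDatum L 2 (Matrix.of fun i j : Fin 2 => if i.val + j.val + 1 = 2 then (1 : L) else 0)).Local v) ×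
      ((cmDatum L 1 (Matrix.of fun i j : Fin 1 => if i.val + j.val + 1 = 1 then (1 : L) else 0)).Local v))) (hτC : ∀ t : ↥(Subgroup.centralizer ({εH} : Set (((cmDatum L 2 (Matrix.of fun i j : Fin 2 => if i.val + j.val + 1 = 2 then (1 : L) else 0)).Local v) ×
      ((cmDatum L 1 (Matrix.of fun i j : Fin 1 => if i.val + j.val + 1 = 1 then (1 : L) else 0)).Local v)))), τ t ∈ Subgroup.centralizer ({t₀} : Set (((cmDatum L 2 (Matrix.of fun i j : Fin 2 => if i.val + j.val + 1 = 2 then (1 : L) else 0)).Local v) ×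
      ((cmDatum L 1 (Matrix.of fun i j : Fin 1 => if i.val + j.val + 1 = 1 then (1 : L) else 0)).Local v))))
    -- (R1-lc) on `C`, for a weight `fac` (the dress: ★ `RankOneUnstableTransferNonsplit` with `fac := μ_w(γ₁ − γ₃)⁻¹ · D_H` in the eigenframe of `t₀`, `Reg := IsLocalGRegular L v`)
    (fac : (((cmDatum L 2 (Matrix.of fun i j : Fin 2 => if i.val + j.val + 1 = 2 then (1 : L) else 0)).Local v) ×
      ((cmDatum L 1 (Matrix.of fun i j : Fin 1 => if i.val + j.val + 1 = 1 then (1 : L) else 0)).Local v)) → ℂ)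
    (hLL : ∀ ψε : (((cmDatum L 2 (Matrix.of fun i j : Fin 2 => if i.val + j.val + 1 = 2 then (1 : L) else 0)).Local v) ×
      ((cmDatum L 1 (Matrix.of fun i j : Fin 1 => if i.val + j.val + 1 = 1 then (1 : L) else 0)).Local v)) → ℂ, IsLocSmooth ψε → ∃ fC : ↥(Subgroup.centralizer ({t₀} : Set (((cmDatum L 2 (Matrix.of fun i j : Fin 2 => if i.val + j.val + 1 = 2 then (1 : L) else 0)).Local v) ×
      ((cmDatum L 1 (Matrix.of fun i j : Fin 1 => if i.val + j.val + 1 = 1 then (1 : L) else 0)).Local v)))) → ℂ, IsLocallyConstant fC ∧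
      ∀ t' : ↥(Subgroup.centralizer ({t₀} : Set (((cmDatum L 2 (Matrix.of fun i j : Fin 2 => if i.val + j.val + 1 = 2 then (1 : L) else 0)).Local v) ×
      ((cmDatum L 1 (Matrix.of fun i j : Fin 1 => if i.val + j.val + 1 = 1 then (1 : L) else 0)).Local v)))), IsLocalGRegular L v (t' : (((cmDatum L 2 (Matrix.of fun i j : Fin 2 => if i.val + j.val + 1 = 2 then (1 : L) else 0)).Local v) ×
      ((cmDatum L 1 (Matrix.of fun i j : Fin 1 => if i.val + j.val + 1 = 1 then (1 : L) else 0)).Local v))) →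
        fac (t' : (((cmDatum L 2 (Matrix.of fun i j : Fin 2 => if i.val + j.val + 1 = 2 then (1 : L) else 0)).Local v) ×
      ((cmDatum L 1 (Matrix.of fun i j : Fin 1 => if i.val + j.val + 1 = 1 then (1 : L) else 0)).Local v))) * (2 * classOrbitalIntegral mH ψε (ConjClasses.mk (t' : (((cmDatum L 2 (Matrix.of fun i j : Fin 2 => if i.val + j.val + 1 = 2 then (1 : L) else 0)).Local v) ×
      ((cmDatum L 1 (Matrix.of fun i j : Fin 1 => if i.val + j.val + 1 = 1 then (1 : L) else 0)).Local v)))) -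
          ∑ᶠ d ∈ {d : ConjClasses (((cmDatum L 2 (Matrix.of fun i j : Fin 2 => if i.val + j.val + 1 = 2 then (1 : L) else 0)).Local v) ×
      ((cmDatum L 1 (Matrix.of fun i j : Fin 1 => if i.val + j.val + 1 = 1 then (1 : L) else 0)).Local v)) | IsLocalStablyConjH L v (t' : (((cmDatum L 2 (Matrix.of fun i j : Fin 2 => if i.val + j.val + 1 = 2 then (1 : L) else 0)).Local v) ×
      ((cmDatum L 1 (Matrix.of fun i j : Fin 1 => if i.val + j.val + 1 = 1 then (1 : L) else 0)).Local v))) (Quotient.out d)}, classOrbitalIntegral mH ψε d) = fC t')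
    -- (J2a) κ-alternation at the torus base
    (halt : ∃ V₁ ∈ 𝓝 b₀, ∀ t ∈ V₁, IsLocalGRegular L v (t : (((cmDatum L 2 (Matrix.of fun i j : Fin 2 => if i.val + j.val + 1 = 2 then (1 : L) else 0)).Local v) ×
      ((cmDatum L 1 (Matrix.of fun i j : Fin 1 => if i.val + j.val + 1 = 1 then (1 : L) else 0)).Local v))) → ∃ d' : ConjClasses (((cmDatum L 2 (Matrix.of fun i j : Fin 2 => if i.val + j.val + 1 = 2 then (1 : L) else 0)).Local v) ×
      ((cmDatum L 1 (Matrix.of fun i j : Fin 1 => if i.val + j.val + 1 = 1 then (1 : L) else 0)).Local v)), d' ≠ ConjClasses.mk (τ t) ∧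
        {d : ConjClasses (((cmDatum L 2 (Matrix.of fun i j : Fin 2 => if i.val + j.val + 1 = 2 then (1 : L) else 0)).Local v) ×
      ((cmDatum L 1 (Matrix.of fun i j : Fin 1 => if i.val + j.val + 1 = 1 then (1 : L) else 0)).Local v)) | IsLocalStablyConjH L v (τ t) (Quotient.out d)} = {ConjClasses.mk (τ t), d'} ∧
        ((finExplicitCollection L H' μ hl hr) v).Δ (t : (((cmDatum L 2 (Matrix.of fun i j : Fin 2 => if i.val + j.val + 1 = 2 then (1 : L) else 0)).Local v) ×
      ((cmDatum L 1 (Matrix.of fun i j : Fin 1 => if i.val + j.val + 1 = 1 then (1 : L) else 0)).Local v))) ((θ (Quotient.out d') : ↥(Subgroup.centralizer ({ε} : Set ((cmDatum L 3 H').Local v)))) : ((cmDatum L 3 H').Local v)) =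
          - ((finExplicitCollection L H' μ hl hr) v).Δ (t : (((cmDatum L 2 (Matrix.of fun i j : Fin 2 => if i.val + j.val + 1 = 2 then (1 : L) else 0)).Local v) ×
      ((cmDatum L 1 (Matrix.of fun i j : Fin 1 => if i.val + j.val + 1 = 1 then (1 : L) else 0)).Local v))) ((θ (Quotient.out (ConjClasses.mk (τ t))) : ↥(Subgroup.centralizer ({ε} : Set ((cmDatum L 3 H').Local v)))) : ((cmDatum L 3 H').Local v)))
    -- (J2b) the explicit-factor split `Δ‴_v(↑t, θ(out ⟦τ t⟧)) = E(t) · fac(τ t)`, `E` locally constant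
    (hfac : ∃ V₂ ∈ 𝓝 b₀, ∃ E : ↥(Subgroup.centralizer ({εH} : Set (((cmDatum L 2 (Matrix.of fun i j : Fin 2 => if i.val + j.val + 1 = 2 then (1 : L) else 0)).Local v) ×
      ((cmDatum L 1 (Matrix.of fun i j : Fin 1 => if i.val + j.val + 1 = 1 then (1 : L) else 0)).Local v)))) → ℂ, IsLocallyConstant E ∧ ∀ t ∈ V₂, IsLocalGRegular L v (t : (((cmDatum L 2 (Matrix.of fun i j : Fin 2 => if i.val + j.val + 1 = 2 then (1 : L) else 0)).Local v) ×
      ((cmDatum L 1 (Matrix.of fun i j : Fin 1 => if i.val + j.val + 1 = 1 then (1 : L) else 0)).Local v))) →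
        ((finExplicitCollection L H' μ hl hr) v).Δ (t : (((cmDatum L 2 (Matrix.of fun i j : Fin 2 => if i.val + j.val + 1 = 2 then (1 : L) else 0)).Local v) ×
      ((cmDatum L 1 (Matrix.of fun i j : Fin 1 => if i.val + j.val + 1 = 1 then (1 : L) else 0)).Local v))) ((θ (Quotient.out (ConjClasses.mk (τ t))) : ↥(Subgroup.centralizer ({ε} : Set ((cmDatum L 3 H').Local v)))) : ((cmDatum L 3 H').Local v)) = E t * fac (τ t)) :
    ∀ ψε : (((cmDatum L 2 (Matrix.of fun i j : Fin 2 => if i.val + j.val + 1 = 2 then (1 : L) else 0)).Local v) ×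
      ((cmDatum L 1 (Matrix.of fun i j : Fin 1 => if i.val + j.val + 1 = 1 then (1 : L) else 0)).Local v)) → ℂ, IsLocSmooth ψε → ∃ V ∈ 𝓝 b₀, ∃ g : ↥(Subgroup.centralizer ({εH} : Set (((cmDatum L 2 (Matrix.of fun i j : Fin 2 => if i.val + j.val + 1 = 2 then (1 : L) else 0)).Local v) ×
      ((cmDatum L 1 (Matrix.of fun i j : Fin 1 => if i.val + j.val + 1 = 1 then (1 : L) else 0)).Local v)))) → ℂ, IsLocallyConstant g ∧
      ∀ t ∈ V, IsLocalGRegular L v (t : (((cmDatum L 2 (Matrix.of fun i j : Fin 2 => if i.val + j.val + 1 = 2 then (1 : L) else 0)).Local v) ×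
      ((cmDatum L 1 (Matrix.of fun i j : Fin 1 => if i.val + j.val + 1 = 1 then (1 : L) else 0)).Local v))) →
        (∑ᶠ d ∈ {d : ConjClasses (((cmDatum L 2 (Matrix.of fun i j : Fin 2 => if i.val + j.val + 1 = 2 then (1 : L) else 0)).Local v) ×
      ((cmDatum L 1 (Matrix.of fun i j : Fin 1 => if i.val + j.val + 1 = 1 then (1 : L) else 0)).Local v)) | IsLocalStablyConjH L v (τ t) (Quotient.out d)},
          ((finExplicitCollection L H' μ hl hr) v).Δ (t : (((cmDatum L 2 (Matrix.of fun i j : Fin 2 => if i.val + j.val + 1 = 2 then (1 : L) else 0)).Local v) ×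
      ((cmDatum L 1 (Matrix.of fun i j : Fin 1 => if i.val + j.val + 1 = 1 then (1 : L) else 0)).Local v))) ((θ (Quotient.out d) : ↥(Subgroup.centralizer ({ε} : Set ((cmDatum L 3 H').Local v)))) : ((cmDatum L 3 H').Local v)) * classOrbitalIntegral mH ψε d) = g t := by
  intro ψε hψε
  obtain ⟨fC, hfClc, hfC⟩ := hLL ψε hψε
  obtain ⟨V₁, hV₁, halt'⟩ := halt
  obtain ⟨V₂, hV₂, E, hE, hfac'⟩ := hfac
  refine ⟨V₁ ∩ V₂, inter_mem hV₁ hV₂, fun t => E t * fC ⟨τ t, hτC t⟩, ?_, ?_⟩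
  · exact hE.mul (hfClc.comp_continuous (hτc.subtype_mk fun t => hτC t))
  rintro t ⟨ht₁, ht₂⟩ hreg
  obtain ⟨d', hd'ne, hset, hΔ'⟩ := halt' t ht₁ hreg
  have hDp := hfac' t ht₂ hreg
  have hC := hfC ⟨τ t, hτC t⟩ (hτreg t hreg)
  rw [finsum_mem_eq_add_of_eq_pair hd'ne.symm hset, hΔ', hDp]
  have hsum : (∑ᶠ d ∈ {d : ConjClasses (((cmDatum L 2 (Matrix.of fun i j : Fin 2 => if i.val + j.val + 1 = 2 then (1 : L) else 0)).Local v) ×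
      ((cmDatum L 1 (Matrix.of fun i j : Fin 1 => if i.val + j.val + 1 = 1 then (1 : L) else 0)).Local v)) | IsLocalStablyConjH L v ((⟨τ t, hτC t⟩ : ↥(Subgroup.centralizer ({t₀} : Set (((cmDatum L 2 (Matrix.of fun i j : Fin 2 => if i.val + j.val + 1 = 2 then (1 : L) else 0)).Local v) ×
      ((cmDatum L 1 (Matrix.of fun i j : Fin 1 => if i.val + j.val + 1 = 1 then (1 : L) else 0)).Local v))))) : (((cmDatum L 2 (Matrix.of fun i j : Fin 2 => if i.val + j.val + 1 = 2 then (1 : L) else 0)).Local v) ×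
      ((cmDatum L 1 (Matrix.of fun i j : Fin 1 => if i.val + j.val + 1 = 1 then (1 : L) else 0)).Local v))) (Quotient.out d)},
        classOrbitalIntegral mH ψε d) =
      classOrbitalIntegral mH ψε (ConjClasses.mk (τ t)) + classOrbitalIntegral mH ψε d' :=
    finsum_mem_eq_add_of_eq_pair hd'ne.symm hset _
  rw [hsum] at hC
  show _ = E t * fC ⟨τ t, hτC t⟩
  rw [← hC]
  ring

end TorusUnstable

end Literature.NumberTheory.Rogawski1990

end
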